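import Summits.RiemannHypothesis.RiemannHypothesis.Theorems.SemilocalDeletionCliff
import Summits.RiemannHypothesis.RiemannHypothesis.Theorems.GroundBartaEvenWinsBeyondArchEndpointLog5Half
import HarnessLib

/-!
# The deletion cliff floor on `C((log 5)/2)`: the `S = {∞, 2}` form is bounded below by `−log 3/√3` (UNCONDITIONAL)

A discharge corollary of `SemilocalDeletionCliff.re_weilSemilocalQuadratic_erase_ge_of_weilPositivityOn` by the kernel theorem
`EvenWinsBeyondArch.weilPositivityOn_log5half` (full Weil positivity on `C((log 5)/2)`): deleting the prime `3`
(`(log 5)/2 < log 3`) from `{2, 3}` (which covers every prime power `≤ 4`) costs at most `(log 3/√3)‖g‖₂²`.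
Seat rh-explicit-cc-s2-1 gen9; nothing here bears on RH.
-/

set_option linter.dupNamespace false

noncomputable section

open Complex Filter Set MeasureTheory
open scoped Real Topology ComplexConjugate

namespace Summit.RiemannHypothesis.RiemannHypothesis.Theorems.SemilocalDeletionCliff

open Literature.NumberTheory.LFunctions

variable {g : ℝ → ℂ}

/-- `(log 5)/2 < log 3` (`5 < 9`). -/
theorem log_five_half_lt_log_three : Real.log 5 / 2 < Real.log 3 := by
  have h9 : Real.log 9 = 2 * Real.log 3 := by
    rw [show (9 : ℝ) = 3 ^ 2 by norm_num, Real.log_pow]; push_cast; ring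
  have h59 : Real.log 5 < Real.log 9 := Real.log_lt_log (by norm_num) (by norm_num)
  linarith

/-- Every prime power `n ≤ 4` is `2`- or `3`-smooth… precisely: its prime lies in any `S ∋ 2, 3`. -/
theorem primeFactors_subset_of_le_four {S : Finset ℕ} (h2 : 2 ∈ S) (h3 : 3 ∈ S) :
    ∀ n ≤ 4, IsPrimePow n → n.primeFactors ⊆ S := by
  intro n hn hpp
  interval_cases n
  · exact absurd hpp (by decide)
  · exact absurd hpp (by decide)
  · rw [Nat.Prime.primeFactors (by norm_num)]; simpa using h2
  · rw [Nat.Prime.primeFactors (by norm_num)]; simpa using h3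
  · rw [show (4 : ℕ) = 2 ^ 2 by norm_num, Nat.primeFactors_prime_pow two_ne_zero Nat.prime_two]; simpa using h2

/-- `(log 5)/2 = (log (4+1))/2` in the window normalisation of `weilSemilocalQuadratic_eq_weilQuadratic_of_forall`. -/
theorem log_five_half_eq : Real.log 5 / 2 = Real.log (((4 : ℕ) : ℝ) + 1) / 2 := by norm_num

/-- **UNCONDITIONAL instance (the `S = {∞, 2}` case on `C((log 5)/2)`).** For every Weil test function supported in
`[−(log 5)/2, (log 5)/2]`: `Re Q_{{2}}(g) ≥ −(log 3/√3)·‖g‖₂²` — from the kernel theorem `weilPositivityOn_log5half`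
(full Weil positivity on that window) by deleting the prime `3` (`(log 5)/2 < log 3`). The numerics say this floor is
the limit of the actual bottoms as the window widens (−0.6303 at `c = 0.85`, free-odd finite sections). -/
theorem re_weilSemilocalQuadratic_two_ge_on_log5half (hg : IsWeilTest g)
    (hsupp : tsupport g ⊆ Icc (-(Real.log 5 / 2)) (Real.log 5 / 2)) :
    -(Real.log 3 / Real.sqrt 3 * ∫ u : ℝ, ‖g u‖ ^ 2) ≤ (weilSemilocalQuadratic {2} g).re := by
  have h23 : ({2, 3} : Finset ℕ).erase 3 = {2} := by decide
  rw [← h23]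
  have h := re_weilSemilocalQuadratic_erase_ge_of_weilPositivityOn (S := {2, 3}) (N := 4) (p := 3) hg
    (primeFactors_subset_of_le_four (by simp) (by simp)) Nat.prime_three (by simp)
    (c := Real.log 5 / 2) (by rw [log_five_half_eq]) EvenWinsBeyondArch.weilPositivityOn_log5half hsupp
    (by exact_mod_cast log_five_half_lt_log_three)
  exact_mod_cast h

end Summit.RiemannHypothesis.RiemannHypothesis.Theorems.SemilocalDeletionCliff

end
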